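import Literature.NumberTheory.EllipticCurves.GreenbergSelmer
import Literature.NumberTheory.GaloisRepresentations.DecompositionGroupOfCompletion
import Literature.NumberTheory.GaloisRepresentations.AbsIntegersEquiv
import Literature.NumberTheory.GaloisRepresentations.AbsGaloisOuterConj
import Literature.NumberTheory.GaloisRepresentations.IntegralGaloisActionProofs
import Literature.NumberTheory.AdelicBaseChange.IntegralClosureLocalization
import Literature.AnabelianGeometry.AbsoluteAnabelian.AbsAnabLevelFieldsProofs
import HarnessLib

/-!
# Crux `PrintCf2.SplitBadTwoRankOneOfFacts` (stmt-BirchSwinnertonDyer-20368), S3n′-FACT-FREE road, brick (P-D):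
# THE LOCAL-GROUPS BRIDGE `Γ_F → Γ_K` — decomposition and inertia groups of the places `w ∣ u` of a finite extension `F/K`
# are the pull-backs of the `Γ_K`-conjugates `σ⁻¹·D_u·σ`, `σ⁻¹·I_u·σ` of the base groups

Cell `bsd-print-cf2`, WIDTH seat `bsd-line-cf2-p1-w6` g6 (prover-bsd-line-cf2-p1-w6-g6-0); `--supports stmt-BirchSwinnertonDyer-20368` (helper,
Theses-free). HONEST FRAMING: Galois-theoretic bookkeeping; nothing here closes the crux or a registered stub; BSD is not proved by any of this;
no summit statement is proved by this seat. No definition, no named fact, no instance, no `sorry`.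

ROLE (memos `Cruxes/SplitBadTwoRankOneOfFacts/S3N-FACTFREE-w2g14.md` §4 R2/R3, `R2-BRICKS-w5g7.md` §0 «the tree has NO bridge carrying LOCAL data
(places of `F`, `decomp (K := F) w′`) to `U ∩ σ D_w σ⁻¹ ≤ Γ_K`», -w7 g6 STATUS 06:11:33Z «the Γ_F ≅ U bridge must carry»): the (PRO-NULL) discharge
over the layer field `F` as a number field ON ITS OWN (-w7 g6 `KummerProNull.proNull_canonical_of_trivial`, Poitou–Tate over `F`) reads local
conditions at the places `w` of `F` through `GreenbergSelmer.decomp (K := F) w = res_{F_w}(Γ_{F_w}) ≤ Γ_F` / `inertia (K := F) w`, while the line's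
layer statements ((LSₙ), -w4 g12 / -w3 g13) live INSIDE `Γ_K` on `decompIn U w = U ⊓ D_w`, `U = κ₂.layerSubgroup n`. This file is the dictionary for
the tree's restriction `res = absGaloisRestrict K F : Γ_F → Γ_K` (any finite — indeed any algebraic — extension of number fields `F/K`):

* §1 `conj_smul_decomp_eq_decompositionSubgroup_smul`, `conj_smul_inertia_eq_inertia_smul` — `σ·D_u·σ⁻¹ = D_{σ𝔓₀}`, `σ·I_u·σ⁻¹ = I_{σ𝔓₀}`
  for the prime `𝔓₀ = adicCompletionPrime K u` of `\bar ℤ_K` cut out by the chosen `K̄ → K̄_u` (tree: `D_{𝔓₀} = D_u`, `I_{𝔓₀} = I_u`, Neukirch II (9.6)).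
* §2 **`exists_comap_conj_decomp_eq_decomp`** — for every place `w ∣ u` of `F` there is `σ ∈ Γ_K` with
  **`res⁻¹(σ·D_u·σ⁻¹) = D_w(F)` and `res⁻¹(σ·I_u·σ⁻¹) = I_w(F)`** (as subgroups of `Γ_F`); image form `res(D_w(F)) = res(Γ_F) ⊓ σ·D_u·σ⁻¹`
  (`map_decomp_eq_range_inf_conj_smul_decomp`). Proof: `D_w(F) = D_{𝔓₀^F}` (Neukirch II (9.6) for `F`), `res⁻¹(D_{ι⁻¹𝔓₀^F}) = D_{𝔓₀^F}`
  (`AbsIntegersEquiv`), `ι⁻¹𝔓₀^F ∣ u` so `ι⁻¹𝔓₀^F = σ𝔓₀` (transitivity of `Γ_K` on the primes above `u`).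
* §3 **`exists_extension_comap_conj_decomp_eq_conj_decomp`** — conversely, for every `σ ∈ Γ_K` there are a place `w ∣ u` of `F` and `τ ∈ Γ_F` with
  `res⁻¹(σ·D_u·σ⁻¹) = τ·D_w(F)·τ⁻¹` (and inertia): the double coset `res(Γ_F)·σ·D_u` IS a place of `F` above `u` (Neukirch I §9 p. 54).
* §4 the INTRINSIC form for a NORMAL finite subextension `L ⊆ K̄` (the layers `K*_n` of a `ℤ_p`-line are such): `res(Γ_L) = Gal(K̄/L) = galFixing K L`
  (`range_absGaloisRestrict_eq_galFixing`, via the tree's `embField_coe_eq_self`), hence **`exists_galFixing_inf_conj_smul_decomp_eq_map_decomp`**: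
  `Gal(K̄/L) ⊓ σ·D_u·σ⁻¹ = res(D_w(L))`, `Gal(K̄/L) ⊓ σ·I_u·σ⁻¹ = res(I_w(L))` — the LINE's `U ⊓ σ D_u σ⁻¹` IS the number field `L`'s own
  decomposition group at the place `w` cut out by `σ`, transported along `res`.

References: J. Neukirch, *Algebraic Number Theory* (1999) I §9 (9.1)–(9.6) and p. 54, II §9 (9.6); J.-P. Serre, *Local Fields* (1979) I §7–§8.
presearch: folklore; tree twins for SPECIAL cases only (`SplitPrimeLocalGaloisTransportProofs` quadratic/split, `SorensenPatching` /
`ToLocalRestrictField` «up to SOME conjugation», `FineSelmerRestrictionDescentProofs` §2 at every prime). beyond-print theorem: no.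
-/

set_option linter.dupNamespace false

noncomputable section

open scoped NumberField Pointwise
open IsDedekindDomain Field
open Literature.NumberTheory.GaloisRepresentations Literature.NumberTheory.EllipticCurves.GreenbergSelmer

namespace Summit.BirchSwinnertonDyer.BirchSwinnertonDyer.Theorems.PrintCf2.LocalGroupsBridge

/-! ## §1. Conjugates of `D_u`, `I_u` are the decomposition / inertia groups of the translated prime `σ𝔓₀` -/

section Base

variable {K : Type} [Field K] [NumberField K] (u : HeightOneSpectrum (𝓞 K))

/-- **`σ·D_u·σ⁻¹ = D_{σ𝔓₀}`** (`𝔓₀ = adicCompletionPrime K u`, `D_{𝔓₀} = D_u` by Neukirch II (9.6)). [cite: NeukirchANT1999, Ch. I §9 (remark after (9.5))] -/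
theorem conj_smul_decomp_eq_decompositionSubgroup_smul (σ : absoluteGaloisGroup K) :
    MulAut.conj σ • decomp u = (σ • adicCompletionPrime K u).decompositionSubgroup (absoluteGaloisGroup K) := by
  rw [Ideal.decompositionSubgroup_smul, decompositionSubgroup_adicCompletionPrime_eq_range]
  rfl

/-- **`σ·I_u·σ⁻¹ = I_{σ𝔓₀}`** (`I_{𝔓₀} = I_u` by Neukirch II (9.6)). [cite: NeukirchANT1999, Ch. I §9 (remark after (9.5))] -/
theorem conj_smul_inertia_eq_inertia_smul (σ : absoluteGaloisGroup K) :
    MulAut.conj σ • inertia u = (σ • adicCompletionPrime K u).inertia (absoluteGaloisGroup K) := by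
  have h0 : inertia u = (adicCompletionPrime K u).inertia (absoluteGaloisGroup K) :=
    (inertia_adicCompletionPrime_eq_map_absInertia K u).symm
  ext g
  rw [h0, Subgroup.mem_pointwise_smul_iff_inv_smul_mem, ← map_inv, MulAut.smul_def, MulAut.conj_apply, inv_inv,
    ← Ideal.conj_mem_inertia_smul_iff (adicCompletionPrime K u) σ (σ⁻¹ * g * σ)]
  simp only [mul_assoc, mul_inv_cancel, mul_one, mul_inv_cancel_left]

end Base

/-! ## §2. For every place `w ∣ u` of `F`: `res⁻¹(σ·D_u·σ⁻¹) = D_w(F)`, `res⁻¹(σ·I_u·σ⁻¹) = I_w(F)` for some `σ ∈ Γ_K` -/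

section Extension

variable {K : Type} [Field K] [NumberField K] (F : Type) [Field F] [NumberField F] [Algebra K F] [Algebra.IsAlgebraic K F]
  (u : HeightOneSpectrum (𝓞 K))

omit [Algebra.IsAlgebraic K F] in
/-- The prime `ι⁻¹(𝔓₀^F(w))` of `\bar ℤ_K` below the prime of `\bar ℤ_F` cut out by `F̄ → F̄_w` lies above `u` when `w ∣ u`.
[cite: NeukirchANT1999, Ch. I §9 Prop. (9.1)] -/
theorem comap_adicCompletionPrime_mem_primesAbove (w : u.Extension (𝓞 F)) :
    (adicCompletionPrime F w.1).comap (absIntegersMap K F) ∈ u.primesAbove :=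
  comap_absIntegersMap_mem_primesAbove (congrArg HeightOneSpectrum.asIdeal w.2) (adicCompletionPrime_mem_primesAbove F w.1)

/-- **THE LOCAL-GROUPS BRIDGE.** For every place `w ∣ u` of `F` there is `σ ∈ Γ_K` such that the decomposition group `D_w(F) ≤ Γ_F` (the
tree's `GreenbergSelmer.decomp (K := F) w`, image of `Γ_{F_w}`) is the pull-back along `res : Γ_F → Γ_K` of the conjugate `σ·D_u·σ⁻¹` of the
base decomposition group, and likewise for inertia. [cite: NeukirchANT1999, Ch. I §9 Prop. (9.1), (9.4)–(9.6)] [cite: NeukirchANT1999, Ch. II §9 Prop. (9.6)] -/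
theorem exists_comap_conj_decomp_eq_decomp (w : u.Extension (𝓞 F)) :
    ∃ σ : absoluteGaloisGroup K,
      (MulAut.conj σ • decomp u).comap (absGaloisRestrict K F).toMonoidHom = decomp (K := F) w.1 ∧
        (MulAut.conj σ • inertia u).comap (absGaloisRestrict K F).toMonoidHom = inertia (K := F) w.1 := by
  obtain ⟨σ, hσ⟩ := HeightOneSpectrum.exists_smul_eq_of_mem_primesAbove_holds (adicCompletionPrime_mem_primesAbove K u)
    (comap_adicCompletionPrime_mem_primesAbove F u w)
  refine ⟨σ, ?_, ?_⟩
  · rw [conj_smul_decomp_eq_decompositionSubgroup_smul, hσ, comap_decompositionSubgroup_comap_absIntegersMap,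
      decompositionSubgroup_adicCompletionPrime_eq_range]
    rfl
  · rw [conj_smul_inertia_eq_inertia_smul, hσ, comap_inertia_comap_absIntegersMap, inertia_adicCompletionPrime_eq_map_absInertia]
    rfl

/-- Image form: **`res(D_w(F)) = res(Γ_F) ⊓ σ·D_u·σ⁻¹` and `res(I_w(F)) = res(Γ_F) ⊓ σ·I_u·σ⁻¹`** for the `σ` of
`exists_comap_conj_decomp_eq_decomp`. [cite: NeukirchANT1999, Ch. I §9 Prop. (9.1), (9.4)–(9.6)] -/
theorem exists_map_decomp_eq_range_inf_conj_smul (w : u.Extension (𝓞 F)) :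
    ∃ σ : absoluteGaloisGroup K,
      (decomp (K := F) w.1).map (absGaloisRestrict K F).toMonoidHom =
          (absGaloisRestrict K F).toMonoidHom.range ⊓ MulAut.conj σ • decomp u ∧
        (inertia (K := F) w.1).map (absGaloisRestrict K F).toMonoidHom =
          (absGaloisRestrict K F).toMonoidHom.range ⊓ MulAut.conj σ • inertia u := by
  obtain ⟨σ, hD, hI⟩ := exists_comap_conj_decomp_eq_decomp F u w
  exact ⟨σ, by rw [← hD, Subgroup.map_comap_eq], by rw [← hI, Subgroup.map_comap_eq]⟩

/-- Elementwise reading: for the `σ` of the bridge, **`res γ ∈ σ·D_u·σ⁻¹ ↔ γ ∈ D_w(F)`** and **`res γ ∈ σ·I_u·σ⁻¹ ↔ γ ∈ I_w(F)`**.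
[cite: NeukirchANT1999, Ch. I §9 Prop. (9.1), (9.4)–(9.6)] -/
theorem exists_forall_absGaloisRestrict_mem_conj_iff (w : u.Extension (𝓞 F)) :
    ∃ σ : absoluteGaloisGroup K, ∀ γ : absoluteGaloisGroup F,
      (absGaloisRestrict K F γ ∈ MulAut.conj σ • decomp u ↔ γ ∈ decomp (K := F) w.1) ∧
        (absGaloisRestrict K F γ ∈ MulAut.conj σ • inertia u ↔ γ ∈ inertia (K := F) w.1) := by
  obtain ⟨σ, hD, hI⟩ := exists_comap_conj_decomp_eq_decomp F u w
  refine ⟨σ, fun γ ↦ ⟨?_, ?_⟩⟩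
  · rw [← hD, Subgroup.mem_comap]; rfl
  · rw [← hI, Subgroup.mem_comap]; rfl

/-! ## §3. Conversely every `σ ∈ Γ_K` comes from a place `w ∣ u` of `F`, up to `Γ_F`-conjugacy -/

/-- **Every double coset `res(Γ_F)·σ·D_u` is a place of `F` above `u`**: for `σ ∈ Γ_K` there are `w ∣ u` and `τ ∈ Γ_F` with
`res⁻¹(σ·D_u·σ⁻¹) = τ·D_w(F)·τ⁻¹` and `res⁻¹(σ·I_u·σ⁻¹) = τ·I_w(F)·τ⁻¹`. [cite: NeukirchANT1999, Ch. I §9 p. 54] -/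
theorem exists_extension_comap_conj_decomp_eq_conj_decomp (σ : absoluteGaloisGroup K) :
    ∃ (w : u.Extension (𝓞 F)) (τ : absoluteGaloisGroup F),
      (MulAut.conj σ • decomp u).comap (absGaloisRestrict K F).toMonoidHom = MulAut.conj τ • decomp (K := F) w.1 ∧
        (MulAut.conj σ • inertia u).comap (absGaloisRestrict K F).toMonoidHom = MulAut.conj τ • inertia (K := F) w.1 := by
  -- the prime `𝔔` of `\bar ℤ_F` corresponding to `σ𝔓₀` under `\bar ℤ_K ≅ \bar ℤ_F`
  set 𝔓 : Ideal (absIntegers (𝓞 K) K) := σ • adicCompletionPrime K u with h𝔓def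
  have h𝔓 : 𝔓 ∈ u.primesAbove := smul_mem_primesAbove (adicCompletionPrime_mem_primesAbove K u) σ
  set 𝔔 : Ideal (absIntegers (𝓞 F) F) := 𝔓.comap (absIntegersEquiv K F).symm.toRingHom with h𝔔def
  have h𝔔𝔓 : 𝔔.comap (absIntegersMap K F) = 𝔓 := by
    have hcomp : (absIntegersEquiv K F).symm.toRingHom.comp (absIntegersMap K F) = RingHom.id _ :=
      RingHom.ext fun x ↦ (absIntegersEquiv K F).symm_apply_apply x
    rw [h𝔔def, Ideal.comap_comap, hcomp, Ideal.comap_id]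
  haveI : 𝔓.IsPrime := h𝔓.1
  haveI : 𝔔.IsPrime := Ideal.comap_isPrime _ 𝔓
  obtain ⟨w₀, hw₀, h𝔔w, -⟩ := exists_heightOneSpectrum_of_comap_absIntegersMap_mem_primesAbove (K := K) (M := F) (𝔔 := 𝔔)
    (h𝔔𝔓 ▸ h𝔓)
  have hwu : w₀.under (𝓞 K) = u := HeightOneSpectrum.ext hw₀
  let w : u.Extension (𝓞 F) := ⟨w₀, hwu⟩
  -- `𝔔` and `𝔓₀^F(w)` both lie above `w`: `𝔔 = τ • 𝔓₀^F`
  obtain ⟨τ, hτ⟩ := HeightOneSpectrum.exists_smul_eq_of_mem_primesAbove_holds (adicCompletionPrime_mem_primesAbove F w₀) h𝔔w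
  refine ⟨w, τ, ?_, ?_⟩
  · rw [conj_smul_decomp_eq_decompositionSubgroup_smul, ← h𝔓def, ← h𝔔𝔓, comap_decompositionSubgroup_comap_absIntegersMap, ← hτ,
      Ideal.decompositionSubgroup_smul, decompositionSubgroup_adicCompletionPrime_eq_range]
    rfl
  · rw [conj_smul_inertia_eq_inertia_smul, ← h𝔓def, ← h𝔔𝔓, comap_inertia_comap_absIntegersMap, ← hτ,
      ← conj_smul_inertia_eq_inertia_smul]

end Extension

/-! ## §4. Normal finite subextensions `L ⊆ K̄`: `res(Γ_L) = Gal(K̄/L)` and the intrinsic form `Gal(K̄/L) ⊓ σ·D_u·σ⁻¹ = res(D_w(L))` -/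

section Normal

open Literature.NumberTheory.GaloisRepresentations.LocalWeilDatum Literature.AnabelianGeometry.AbsoluteAnabelian

variable {K : Type} [Field K] [NumberField K] (L : IntermediateField K (AlgebraicClosure K)) [Normal K L]

omit [NumberField K] in
/-- **`res(Γ_L) = Gal(K̄/L)`** for a normal subextension `L ⊆ K̄` of `K`: the range of `absGaloisRestrict K L` is `galFixing K L` (tree:
`range res = galFixing K (embField K L)` and `embField K L = L` for `L` normal). [cite: NeukirchANT1999, Ch. IV §1 (1.1)] -/
theorem range_absGaloisRestrict_eq_galFixing : (absGaloisRestrict K L).toMonoidHom.range = galFixing K L := by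
  have hE : galFixing K (embField K L) = galFixing K L := by rw [embField_coe_eq_self L]
  ext γ
  rw [MonoidHom.mem_range, ← hE]
  exact ⟨fun ⟨σ, hσ⟩ ↦ hσ ▸ absGaloisRestrict_mem_galFixing K L σ, fun h ↦ exists_absGaloisRestrict_eq K L h⟩

variable [NumberField L] (u : HeightOneSpectrum (𝓞 K))

/-- **THE LINE's LOCAL GROUP IS THE LAYER FIELD's DECOMPOSITION GROUP.** For a normal finite `L ⊆ K̄` and a place `w ∣ u` of `L` there is
`σ ∈ Γ_K` with `Gal(K̄/L) ⊓ σ·D_u·σ⁻¹ = res(D_w(L))` and `Gal(K̄/L) ⊓ σ·I_u·σ⁻¹ = res(I_w(L))`.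
[cite: NeukirchANT1999, Ch. I §9 Prop. (9.1), (9.4)–(9.6)] [cite: NeukirchANT1999, Ch. II §9 Prop. (9.6)] -/
theorem exists_galFixing_inf_conj_smul_decomp_eq_map_decomp (w : u.Extension (𝓞 L)) :
    ∃ σ : absoluteGaloisGroup K,
      galFixing K L ⊓ MulAut.conj σ • decomp u = (decomp (K := L) w.1).map (absGaloisRestrict K L).toMonoidHom ∧
        galFixing K L ⊓ MulAut.conj σ • inertia u = (inertia (K := L) w.1).map (absGaloisRestrict K L).toMonoidHom := by
  obtain ⟨σ, hD, hI⟩ := exists_map_decomp_eq_range_inf_conj_smul L u w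
  exact ⟨σ, by rw [hD, range_absGaloisRestrict_eq_galFixing], by rw [hI, range_absGaloisRestrict_eq_galFixing]⟩

/-- Converse, intrinsic form: for every `σ ∈ Γ_K` there are `w ∣ u` and `τ ∈ Γ_L` with
`Gal(K̄/L) ⊓ σ·D_u·σ⁻¹ = res(τ·D_w(L)·τ⁻¹)` and `Gal(K̄/L) ⊓ σ·I_u·σ⁻¹ = res(τ·I_w(L)·τ⁻¹)`. [cite: NeukirchANT1999, Ch. I §9 p. 54] -/
theorem exists_extension_galFixing_inf_conj_smul_decomp_eq_map (σ : absoluteGaloisGroup K) :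
    ∃ (w : u.Extension (𝓞 L)) (τ : absoluteGaloisGroup L),
      galFixing K L ⊓ MulAut.conj σ • decomp u = (MulAut.conj τ • decomp (K := L) w.1).map (absGaloisRestrict K L).toMonoidHom ∧
        galFixing K L ⊓ MulAut.conj σ • inertia u = (MulAut.conj τ • inertia (K := L) w.1).map (absGaloisRestrict K L).toMonoidHom := by
  obtain ⟨w, τ, hD, hI⟩ := exists_extension_comap_conj_decomp_eq_conj_decomp L u σ
  refine ⟨w, τ, ?_, ?_⟩
  · rw [← hD, Subgroup.map_comap_eq, range_absGaloisRestrict_eq_galFixing]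
  · rw [← hI, Subgroup.map_comap_eq, range_absGaloisRestrict_eq_galFixing]

end Normal

end Summit.BirchSwinnertonDyer.BirchSwinnertonDyer.Theorems.PrintCf2.LocalGroupsBridge
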